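import Summits.CriticalPhenomena.CardyFormulaZ2.Theorems.CardyUSTContinuationKirchhoffExtremalLengthTraversal

/-!
# Kirchhoff's theorem for the UST limit of the jointly wired FK model, IV: the bush–tree
# correspondence and Dirichlet's principle for vertex sets

Support file for `KirchhoffExtremalLength` (route CardyUSTContinuation of `CardyFormulaZ2`, item
stmt-CriticalPhenomena-11234); part of the proof of Kirchhoff's theorem for the uniform-spanning-tree
limit of the jointly wired FK model (`coeff_div_coeff_eq_toReal_effectiveConductance`, part V).
This part: the bijection `ω ↦ ω + zw` between minimisers rooting `z` but not `w` in `B₁` and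
crossing configurations traversing `zw` (`card_bush_eq_card_tree`), and Dirichlet's principle for a
potential harmonic off `A ∪ Z` with prescribed flux out of `A`
(`effectiveConductance_eq_of_harmonic_sets`).
-/

noncomputable section

namespace Summit.CriticalPhenomena.CardyFormulaZ2.Theorems

namespace KirchhoffSlope

open Finset SimpleGraph
open Literature.Probability.LatticeModels Literature.Probability.Percolation

variable {V : Type*} [DecidableEq V]

/-! ### §8. The bush–tree correspondence -/

section BushTree

variable [Fintype V] {G : SimpleGraph V} [DecidableRel G.Adj] {W : Set V} {m : ℕ}
  {B₁ B₂ : Set V}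

/-- **Bush ↦ tree.** If `ω` is a minimiser in which `z` is rooted in `B₁` and its `G`-neighbour
`w` is not, then `ω + zw` is a crossing configuration of exponent `m + 1` (the new edge joins the
tree of `z`, rooted in `B₁`, to the tree of `w`, rooted in `B₂`, without changing the wired
cluster count). [folklore] -/
theorem insert_traversed
    (hm : ∀ ω ⊆ G.edgeFinset, m ≤ #ω + 2 * clusterCount (↑ω : BondConfig V) W)
    (hB₁ : B₁ ⊆ W) (hW : W ⊆ B₁ ∪ B₂)
    {ω : Finset (Sym2 V)} (hω : ω ⊆ G.edgeFinset) (hE : #ω + 2 * clusterCount (↑ω : BondConfig V) W = m)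
    {z w : V} (hza : ∃ a ∈ B₁, (openGraph (↑ω : BondConfig V)).Reachable z a)
    (hn : ¬ ∃ a ∈ B₁, (openGraph (↑ω : BondConfig V)).Reachable w a) (hzw : G.Adj z w) :
    s(z, w) ∉ ω ∧ insert s(z, w) ω ⊆ G.edgeFinset ∧
      #(insert s(z, w) ω) + 2 * clusterCount (↑(insert s(z, w) ω) : BondConfig V) W = m + 1 ∧
      ∃ a ∈ B₁, ∃ b ∈ B₂, (openGraph (↑(insert s(z, w) ω) : BondConfig V)).Reachable a b := by
  obtain ⟨a, ha, hza⟩ := hza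
  have he : s(z, w) ∉ ω := fun he =>
    hn ⟨a, ha, (Adj.reachable ((openGraph_adj _ _ _).2 ⟨by rwa [Sym2.eq_swap], hzw.symm.ne⟩)).trans hza⟩
  have hsub : insert s(z, w) ω ⊆ G.edgeFinset := Finset.insert_subset (mem_edgeFinset.2 hzw) hω
  have hk : clusterCount (↑(insert s(z, w) ω) : BondConfig V) W = clusterCount (↑ω : BondConfig V) W :=
    clusterCount_insert_eq_of_reachable (reachable_of_adj_of_minimal hm hω hE hzw)
  obtain ⟨b, hb, hwb⟩ := exists_root_mem_of_not hm hB₁ hW hω hE ha hza hzw hn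
  have mono : openGraph (↑ω : BondConfig V) ≤ openGraph (↑(insert s(z, w) ω) : BondConfig V) :=
    openGraph_mono (Finset.coe_subset.2 (Finset.subset_insert _ _))
  have hadj : (openGraph (↑(insert s(z, w) ω) : BondConfig V)).Adj z w :=
    (openGraph_adj _ _ _).2 ⟨Finset.mem_insert_self _ _, hzw.ne⟩
  refine ⟨he, hsub, ?_, a, ha, b, hb, (hza.symm.mono mono).trans (hadj.reachable.trans (hwb.mono mono))⟩
  rw [hk, Finset.card_insert_of_notMem he]
  omega

open scoped Classical in
/-- **The bush–tree correspondence is a bijection** `ω ↦ ω + zw`, `ω' ↦ ω' ∖ zw` between the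
minimisers in which `z` is rooted in `B₁` and `w` is not, and the crossing configurations of
exponent `m + 1` in which `zw` is traversed from `z` to `w`. [folklore] -/
theorem card_bush_eq_card_tree
    (hm : ∀ ω ⊆ G.edgeFinset, m ≤ #ω + 2 * clusterCount (↑ω : BondConfig V) W)
    (hB₁ : B₁ ⊆ W) (hW : W ⊆ B₁ ∪ B₂) {z w : V} (hzw : G.Adj z w) :
    #(G.edgeFinset.powerset.filter fun ω =>
        #ω + 2 * clusterCount (↑ω : BondConfig V) W = m ∧
        (∃ a ∈ B₁, (openGraph (↑ω : BondConfig V)).Reachable z a) ∧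
        ¬ ∃ a ∈ B₁, (openGraph (↑ω : BondConfig V)).Reachable w a) =
    #(G.edgeFinset.powerset.filter fun ω' =>
        (#ω' + 2 * clusterCount (↑ω' : BondConfig V) W = m + 1 ∧
          ∃ a ∈ B₁, ∃ b ∈ B₂, (openGraph (↑ω' : BondConfig V)).Reachable a b) ∧
        (s(z, w) ∈ ω' ∧
        #(ω'.erase s(z, w)) + 2 * clusterCount (↑(ω'.erase s(z, w)) : BondConfig V) W = m ∧
        (∃ a ∈ B₁, (openGraph (↑(ω'.erase s(z, w)) : BondConfig V)).Reachable z a) ∧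
        ¬ ∃ a ∈ B₁, (openGraph (↑(ω'.erase s(z, w)) : BondConfig V)).Reachable w a)) := by
  refine Finset.card_nbij' (fun ω => insert s(z, w) ω) (fun ω' => ω'.erase s(z, w)) ?_ ?_ ?_ ?_
  · intro ω hω
    rw [Finset.mem_coe, Finset.mem_filter, Finset.mem_powerset] at hω ⊢
    obtain ⟨he, hsub, hE1, hcross⟩ := insert_traversed hm hB₁ hW hω.1 hω.2.1 hω.2.2.1 hω.2.2.2 hzw
    refine ⟨hsub, ⟨hE1, hcross⟩, Finset.mem_insert_self _ _, ?_⟩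
    rw [Finset.erase_insert he]
    exact hω.2
  · intro ω' hω'
    rw [Finset.mem_coe, Finset.mem_filter, Finset.mem_powerset] at hω' ⊢
    exact ⟨(Finset.erase_subset _ _).trans hω'.1, hω'.2.2.2⟩
  · intro ω hω
    rw [Finset.mem_coe, Finset.mem_filter, Finset.mem_powerset] at hω
    have he : s(z, w) ∉ ω := (insert_traversed hm hB₁ hW hω.1 hω.2.1 hω.2.2.1 hω.2.2.2 hzw).1
    exact Finset.erase_insert he
  · intro ω' hω'
    rw [Finset.mem_coe, Finset.mem_filter] at hω'
    exact Finset.insert_erase hω'.2.2.1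

end BushTree


/-! ### §9. Dirichlet's principle for a harmonic interpolant between two vertex sets -/

section Dirichlet

open scoped ENNReal NNReal

variable [Fintype V] (G : SimpleGraph V) [DecidableRel G.Adj]

/-- **Dirichlet's principle for a harmonic interpolant, vertex-set version.** If `N : V → ℝ`
equals `D > 0` on `A`, `0` on `Z`, its weighted Laplacian vanishes off `A ∪ Z` and its total flux
out of `A` is `Tw`, then `𝒞(A ↔ Z) = Tw / D` (Lyons–Peres 2016, Exercise 2.13; the singleton
case is `effectiveConductance_eq_of_harmonic` of the tree). [cite: LyonsPeres2016, §2.4 Exercise 2.13] -/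
theorem effectiveConductance_eq_of_harmonic_sets (c : Sym2 V → ℝ≥0) {A Z : Set V}
    [DecidablePred (· ∈ A)] (N : V → ℝ) {D Tw : ℝ} (hD : 0 < D) (hNA : ∀ x ∈ A, N x = D)
    (hNZ : ∀ y ∈ Z, N y = 0)
    (hharm : ∀ z, z ∉ A → z ∉ Z →
      ∑ w, (if G.Adj z w then (c s(z, w) : ℝ) * (N z - N w) else 0) = 0)
    (hflux : ∑ z, (if z ∈ A then
      ∑ w, (if G.Adj z w then (c s(z, w) : ℝ) * (N z - N w) else 0) else 0) = Tw) :
    effectiveConductance G c A Z = ENNReal.ofReal (Tw / D) := by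
  -- the candidate minimiser and its Laplacian
  set v₀ : V → ℝ := fun z ↦ N z / D with hv₀
  have hv₀A : ∀ x ∈ A, v₀ x = 1 := fun x hx => by simp [hv₀, hNA x hx, hD.ne']
  have hv₀Z : ∀ y ∈ Z, v₀ y = 0 := fun y hy => by simp [hv₀, hNZ y hy]
  have hlap : ∀ z, ∑ w, (if G.Adj z w then (c s(z, w) : ℝ) * (v₀ z - v₀ w) else 0) =
      (∑ w, (if G.Adj z w then (c s(z, w) : ℝ) * (N z - N w) else 0)) / D := fun z ↦ by
    rw [div_eq_mul_inv, Finset.sum_mul]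
    refine Finset.sum_congr rfl fun w _ ↦ ?_
    split_ifs
    · simp only [hv₀]
      ring
    · rw [zero_mul]
  have hterm : ∀ z, v₀ z * ((∑ w, (if G.Adj z w then (c s(z, w) : ℝ) * (N z - N w) else 0)) / D) =
      (if z ∈ A then ∑ w, (if G.Adj z w then (c s(z, w) : ℝ) * (N z - N w) else 0) else 0) / D := by
    intro z
    by_cases hzA : z ∈ A
    · rw [if_pos hzA, hv₀A z hzA, one_mul]
    · rw [if_neg hzA, zero_div]
      by_cases hzZ : z ∈ Z
      · rw [hv₀Z z hzZ, zero_mul]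
      · rw [hharm z hzA hzZ, zero_div, mul_zero]
  -- real energies
  set E : (V → ℝ) → ℝ := fun v ↦ ∑ e ∈ G.edgeFinset, (c e : ℝ) * sqIncr v e with hE
  have hE₀ : E v₀ = Tw / D := by
    calc E v₀ = ∑ e ∈ G.edgeFinset, (c e : ℝ) *
          Sym2.lift ⟨fun a b ↦ (v₀ a - v₀ b) * (v₀ a - v₀ b), fun a b ↦ by ring⟩ e := by
            simp only [hE, sqIncr_eq_lift]
      _ = ∑ z, v₀ z * ∑ w, (if G.Adj z w then (c s(z, w) : ℝ) * (v₀ z - v₀ w) else 0) :=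
            sum_edgeFinset_mul_incr G c v₀ v₀
      _ = ∑ z, (if z ∈ A then ∑ w, (if G.Adj z w then (c s(z, w) : ℝ) * (N z - N w) else 0) else 0) / D := by
            refine Finset.sum_congr rfl fun z _ ↦ ?_
            rw [hlap z, hterm z]
      _ = Tw / D := by rw [← Finset.sum_div, hflux]
  have hEv : ∀ v : V → ℝ, (∀ x ∈ A, v x = 1) → (∀ y ∈ Z, v y = 0) → E v₀ ≤ E v := fun v hvA hvZ ↦ by
    have hcross : ∑ e ∈ G.edgeFinset, (c e : ℝ) *
        Sym2.lift ⟨fun a b ↦ ((v a - v₀ a) - (v b - v₀ b)) * (v₀ a - v₀ b), fun a b ↦ by ring⟩ e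
          = 0 := by
      rw [sum_edgeFinset_mul_incr G c (fun z ↦ v z - v₀ z) v₀]
      refine Finset.sum_eq_zero fun z _ ↦ ?_
      by_cases hzA : z ∈ A
      · rw [hvA z hzA, hv₀A z hzA, sub_self, zero_mul]
      · by_cases hzZ : z ∈ Z
        · rw [hvZ z hzZ, hv₀Z z hzZ, sub_self, zero_mul]
        · rw [hlap z, hharm z hzA hzZ, zero_div, mul_zero]
    have hsplit : E v = E v₀ + 2 * ∑ e ∈ G.edgeFinset, (c e : ℝ) *
        Sym2.lift ⟨fun a b ↦ ((v a - v₀ a) - (v b - v₀ b)) * (v₀ a - v₀ b), fun a b ↦ by ring⟩ e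
          + E (fun z ↦ v z - v₀ z) := by
      simp only [hE, Finset.mul_sum, ← Finset.sum_add_distrib]
      refine Finset.sum_congr rfl fun e _ ↦ ?_
      rw [sqIncr_eq_sqIncr_add v v₀ e]
      ring
    have hnonneg : 0 ≤ E (fun z ↦ v z - v₀ z) :=
      Finset.sum_nonneg fun e _ ↦ mul_nonneg (NNReal.coe_nonneg _) (sqIncr_nonneg _ e)
    rw [hsplit, hcross, mul_zero, add_zero]
    linarith
  -- conclude
  refine le_antisymm ?_ (le_effectiveConductance fun v hA hZ ↦ ?_)
  · calc effectiveConductance G c A Z ≤ networkEnergy G c v₀ :=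
          effectiveConductance_le_networkEnergy (fun z hz ↦ hv₀A z hz) (fun z hz ↦ hv₀Z z hz)
      _ = ENNReal.ofReal (Tw / D) := by rw [networkEnergy_eq_ofReal_sum, ← hE₀]
  · rw [networkEnergy_eq_ofReal_sum, ← hE₀]
    exact ENNReal.ofReal_le_ofReal (hEv v (fun x hx ↦ hA hx) (fun y hy ↦ hZ hy))

end Dirichlet

end KirchhoffSlope

end Summit.CriticalPhenomena.CardyFormulaZ2.Theorems
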